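import Literature.AlgebraicGeometry.HodgeTheory.BettiUniverseHodgeRiemannDegreeOne
import Literature.AlgebraicGeometry.HodgeTheory.BettiUniverseHodgeRiemannPositive
import Literature.AlgebraicGeometry.HodgeTheory.HodgeIndexSurfaceSigned
import Literature.AlgebraicGeometry.HodgeTheory.ComplexGysin
import HarnessLib

/-!
# `BettiUniverse.HodgeRiemann10` holds: Hodge–Riemann for `H^{1,0}` on a surface, with sign (Voisin I Thm. 6.32, `k = 1`)

Family `hodge`, layer `Literature/AlgebraicGeometry/HodgeTheory`. Theorems only (no definition, no named fact): the
DISCHARGE of the named fact `BettiUniverse.HodgeRiemann10` of `BettiUniverseHodgeRiemannDegreeOne` (row B3-24 (b1) of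
the `hodgecm-mathlib` cell), along the road the tree already used for `(2,0)`-classes
(`BettiUniverse.hodgeRiemann20_positive`, `BettiUniverse.HodgeRiemann20_holds`):

* `exists_kaehlerRationalDatum_eta_eq` — a rational class `ω ∈ H²(X(ℂ); ℚ)` whose complexification is a Kähler class
  (`IsKaehlerClass n X (ofRatClass _ 2 ω)`, file `KaehlerClass`) IS the class `D.η` of a Kähler–rational datum `D`
  (`KaehlerRationalDatum`, file `HodgeRiemannPolarizabilityProofs`): the two records have the same fields.
* `HodgeRiemann10_holds` — for `0 ≠ α ∈ F¹(ℂ ⊗_ℚ H¹)` read in a real model `A`: `ξ = Θ'α` is of type `(1,0)`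
  (`isOfHodgeType_of_mem_hodgeStructure_F_self`), PRIMITIVE because `L² ξ ∈ H⁵(X(ℂ); ℂ) = 0`
  (`subsingleton_complexBetti`); the tree's signed Hodge–Riemann `KaehlerRationalDatum.hodgeRiemann_X` at `a = 1`,
  `(s,t') = (1,0)`, `r₀ = 1` gives `i • ((H_η ∪ ξ) ∪ ξ̄) = t • Ω` with `t > 0`; associativity and graded commutativity of
  the cup product (`cupProduct_assoc`, `cupProduct_gradedComm_holds`, even degree) turn the left side into
  `(ξ ∪ ξ̄) ∪ H_η`; `H_η ∪ H_η = Ω` (`KaehlerRationalDatum.cupProduct_Hη_Hη`); and the light trace is a fixed multiple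
  of the complex top coordinate (`trC_eq_smul_cTopCoord`), the complexification `Θ'` being multiplicative
  (`ofRatClassBaseChange_cup2`) and compatible with `conj` (`KaehlerRationalDatum.ofRatClassBaseChange_conj`).

## References
* [VoisinHodgeI2002] C. Voisin, *Hodge Theory and Complex Algebraic Geometry I*, CUP 2002, §6.3.2 Thm. 6.32 (k = 1),
  Rem. 6.33; §6.2.3 Lemma 6.24; §3.1.3 Cor. 3.9.
* [HatcherAT2002] A. Hatcher, *Algebraic Topology*, CUP 2002, §3.2 Thm. 3.11 (graded commutativity), p. 211.
-/

noncomputable section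

open scoped TensorProduct
open Module
open Literature.AlgebraicTopology.SingularHomology
open Literature.Geometry.Kaehler (lefschetzPow lefschetzPow_succ lefschetzPow_zero lefschetzOperator_apply)
open Literature.AlgebraicGeometry.Motives (bettiCohomology bettiCup ofRatClassBaseChange ofRatClassBaseChange_tmul)

namespace Literature.AlgebraicGeometry.HodgeTheory

namespace BettiUniverse

variable {X : Motives.SchemeOver ℂ}

/-- **A rational class whose complexification is a Kähler class is the class of a Kähler–rational datum**
(`IsKaehlerClass` and `KaehlerRationalDatum` carry the same data: Hodge model, natural multiplicative real de Rham
family, Kähler metric, comparison identity). [cite: VoisinHodgeI2002, §3.1.3 (Kähler class) and §7.1.2 Thm. 7.10] -/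
theorem exists_kaehlerRationalDatum_eta_eq {n : ℕ} (ω : bettiCohomology X 2)
    (hω : IsKaehlerClass n X (ofRatClass (Motives.ComplexPoints X) 2 ω)) :
    ∃ D : KaehlerRationalDatum n X, D.η = ω := by
  obtain ⟨A, hsm, g, hg, e, he, hem, hH⟩ := hω
  exact ⟨⟨A, e, he, hem, g, hg, ω, hH⟩, rfl⟩

/-- **`BettiUniverse.HodgeRiemann10` holds**: for `X` smooth projective of dimension `2`, a real Hodge model `A`,
`ω ∈ H²(X(ℂ); ℚ)` with Kähler complexification and `0 ≠ α ∈ F¹(ℂ ⊗_ℚ H¹(X(ℂ); ℚ))`, there is `t > 0` with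
`i · trC((α ∪ ᾱ) ∪ ω) = t · trC(ω ∪ ω)` — Voisin I Thm. 6.32 at `k = 1`, `(p,q) = (1,0)` (every degree-1 class is
primitive), divided by the volume `∫_X ω² > 0`; proved from the tree's `KaehlerRationalDatum.hodgeRiemann_X`.
[cite: VoisinHodgeI2002, §6.3.2 Thm. 6.32 (k = 1) and Rem. 6.33] -/
theorem HodgeRiemann10_holds : HodgeRiemann10 := by
  intro X hX A hA ω hω α hα h0
  obtain ⟨D, rfl⟩ := exists_kaehlerRationalDatum_eta_eq ω hω
  set ξ : complexBetti X 1 := ofRatClassBaseChange (Motives.ComplexPoints X) 1 α with hξ_def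
  -- `ξ` is of type `(1,0)` and non-zero
  have h10 : IsOfHodgeType 2 X 1 1 0 ξ :=
    isOfHodgeType_of_mem_hodgeStructure_F_self hX A hA.isHodgeSymmetric 1 hα
  have hξ0 : ξ ≠ 0 := fun h ↦ h0 (ofRatClassBaseChange_injective _ 1 (by rw [← hξ_def, h, map_zero]))
  -- every degree-1 class is primitive: `L² ξ ∈ H⁵(X(ℂ); ℂ) = 0`
  have hprim : lefschetzPow D.Hη (1 + 1) 1 ξ = 0 := by
    haveI := subsingleton_complexBetti hX (show 2 * 2 < 1 + 2 * (1 + 1) by norm_num)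
    exact Subsingleton.elim _ _
  -- Hodge–Riemann on `X(ℂ)`: `i • (L ξ ∪ ξ̄) = t • Ω`, `t > 0`
  obtain ⟨t, ht, heq⟩ :=
    D.hodgeRiemann_X hX (a := 1) (s := 1) (t' := 0) (r₀ := 1) rfl rfl h10 hξ0 hprim
  have hscal : (Complex.I ^ ((1 : ℕ) - (0 : ℕ) : ℤ) * (-1) ^ (1 * (1 - 1) / 2) : ℂ) = Complex.I := by
    norm_num
  rw [hscal] at heq
  -- `L ξ = H_η ∪ ξ`
  rw [lefschetzPow_succ, LinearMap.comp_apply, lefschetzPow_zero, LinearMap.id_apply,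
    lefschetzOperator_apply] at heq
  -- `(H_η ∪ ξ) ∪ ξ̄ = (ξ ∪ ξ̄) ∪ H_η` (associativity, graded commutativity in even degree)
  have hk : 2 + (1 + 1) = 2 * 2 := rfl
  have hk' : (1 + 1) + 2 = 2 * 2 := rfl
  rw [cupProduct_assoc (show 2 + 1 = 1 + 2 * 1 from rfl) (rfl : 1 + 1 = 1 + 1)
      (show 1 + 2 * 1 + 1 = 2 * 2 from rfl) hk,
    cupProduct_gradedComm_holds ℂ (Motives.ComplexPoints X) hk hk'] at heq
  have hsign : ((-1 : ℂ) ^ (2 * (1 + 1))) = 1 := by norm_num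
  rw [hsign, one_smul] at heq
  -- read `heq` through the complex top coordinate
  have hc := congrArg (cTopCoord hX) heq
  rw [map_smul, map_smul, smul_eq_mul, smul_eq_mul] at hc
  -- the two sides of the goal, read in `H⁴(X(ℂ); ℂ)`
  have hη : ofRatClassBaseChange (Motives.ComplexPoints X) 2 ((1 : ℂ) ⊗ₜ[ℚ] D.η) = D.Hη := by
    rw [ofRatClassBaseChange_tmul, one_smul]
  have h11 : ofRatClassBaseChange (Motives.ComplexPoints X) 2
      (LinearMap.BilinMap.baseChange ℂ (cup X 1 1) α (Motives.HodgeStructure.conj α)) =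
        cupProduct rfl ξ (conjClass _ 1 ξ) := by
    have h := ofRatClassBaseChange_cup2 X 1 α (Motives.HodgeStructure.conj α)
    rw [KaehlerRationalDatum.ofRatClassBaseChange_conj hX A] at h
    exact h
  have hL : ofRatClassBaseChange (Motives.ComplexPoints X) (2 + 2)
      (LinearMap.BilinMap.baseChange ℂ (cup X 2 2)
        (LinearMap.BilinMap.baseChange ℂ (cup X 1 1) α (Motives.HodgeStructure.conj α)) (1 ⊗ₜ[ℚ] D.η)) =
        cupProduct hk' (cupProduct rfl ξ (conjClass _ 1 ξ)) D.Hη := by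
    rw [ofRatClassBaseChange_cup2, h11, hη]
  have hR : ofRatClassBaseChange (Motives.ComplexPoints X) (2 + 2)
      (LinearMap.BilinMap.baseChange ℂ (cup X 2 2) (1 ⊗ₜ[ℚ] D.η) (1 ⊗ₜ[ℚ] D.η)) = D.topClass := by
    rw [ofRatClassBaseChange_cup2, hη]
    exact D.cupProduct_Hη_Hη rfl
  refine ⟨t, ht, ?_⟩
  have e₁ := trC_eq_smul_cTopCoord hX (LinearMap.BilinMap.baseChange ℂ (cup X 2 2)
    (LinearMap.BilinMap.baseChange ℂ (cup X 1 1) α (Motives.HodgeStructure.conj α)) (1 ⊗ₜ[ℚ] D.η))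
  have e₂ := trC_eq_smul_cTopCoord hX
    (LinearMap.BilinMap.baseChange ℂ (cup X 2 2) (1 ⊗ₜ[ℚ] D.η) (1 ⊗ₜ[ℚ] D.η))
  change Complex.I * trC hX (2 * 2) _ = (t : ℂ) * trC hX (2 * 2) _
  rw [e₁, e₂]
  change Complex.I * ((tr hX (2 * 2) (ratTopVec hX) : ℂ) *
      cTopCoord hX (ofRatClassBaseChange (Motives.ComplexPoints X) (2 + 2) _)) =
    (t : ℂ) * ((tr hX (2 * 2) (ratTopVec hX) : ℂ) *
      cTopCoord hX (ofRatClassBaseChange (Motives.ComplexPoints X) (2 + 2) _))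
  rw [hL, hR, ← mul_assoc, mul_comm Complex.I, mul_assoc, hc]
  ring

end BettiUniverse

end Literature.AlgebraicGeometry.HodgeTheory

end
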